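import Literature.Geometry.Kaehler.ComplexTorusConeOfCurvesDuality
import Literature.Analysis.Convex.MinkowskiWeylPointedCone
import HarnessLib

/-!
# `NE̅(X)` is polyhedral iff `Nef(X)` is polyhedral: the nef cone and the closed cone of curves of a
# complex abelian variety as mutually dual H-cones, and Minkowski–Weyl

Layer `Literature/Geometry/Kaehler`, namespace `Literature.Geometry.Kaehler.ComplexTorus`; lane
`lit-hodgefound`, seat p07 (generation 45), programme «THE NEF CONE OF AN ABELIAN VARIETY», file 60 of the
seat lineage; sequel of `ComplexTorusConeOfCurvesDuality` (file 59: in the coordinates of a `ℤ`-basis `b` of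
`NS(X)`, `Nef(X) = NE(X)^∨` — `IsAbelianVariety.semipos_sum_smul_iff_forall_curve_sum_mul_nonneg` — and the
bipolar `NE̅(X) = Nef(X)^∨` — `IsAbelianVariety.closure_span_curveCoords_eq`,
`sum_mul_nonneg_of_mem_closure_span_curveCoords`) and of the tree's Farkas–Minkowski–Weyl theorem for Mathlib's
pointed cones (`Literature.Analysis.Convex.FarkasMinkowskiWeyl.fg_iff_dualFG_dotProduct`: a pointed cone of
`κ → 𝕜` is finitely generated iff it is the dual of a finite set), all consumed BY NAME.  Theorems only (no
definition, no named fact, no instance, no notation; net debt `0`).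

THE SOURCES, VERBATIM.  Th. Bauer, *On the cone of curves of an abelian variety*, Amer. J. Math. 120 (1998),
§4 (arXiv p. 5): "recall that the nef cone `Nef(X) ⊂ NS_ℝ(X)` is the dual of `NE̅(X)` […] The dual of
`Nef(X)` in turn is the closed cone `NE̅(X)`.  So the statement that `NE̅(X)` is rational polyhedral is
equivalent to (i)' The nef cone `Nef(X)` is rational polyhedral"; J. Kollár, S. Mori, *Birational Geometry
of Algebraic Varieties*, §1.3 (p. 19 of the held copy): "The closure of the cone of nef divisors is dual to
the cone of effective 1-cycles"; A. Schrijver, *Theory of Linear and Integer Programming*, §7.2 Cor. 7.1a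
(p. 87): "A convex cone is polyhedral if and only if it is finitely generated."

THE MODEL (as in file 59).  `b` a `ℤ`-basis of `NS(X)`, `N₁(X)_ℝ ≅ ℝⁿ` by `z ↦ (b_j · z)_j`, the class of an
irreducible curve `C` is `[C]_b = (C · b_j)_j`, `NE(X)_b` the `ℝ≥0`-span of these classes and `NE̅(X)_b` its
closure; the nef cone in coordinates is `Nef(X)_b = {c ∈ ℝⁿ | H_{Σ c_j b_j} ≥ 0}`; the pairing is the dot
product `c ⬝ᵥ w = Σ_j c_j w_j` (Mathlib's `dotProductBilin`), and for a set `s ⊆ ℝⁿ` Mathlib's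
`PointedCone.dual (dotProductBilin ℝ ℝ) s = {y | ∀ x ∈ s, 0 ≤ x ⬝ᵥ y}` is its closed dual cone (an "H-cone" when
`s` is finite, `PointedCone.DualFG`).
* §1 **BOTH CONES ARE DUAL CONES** (H-descriptions): `IsAbelianVariety.coe_dual_curveCoords_eq` (`Nef(X)_b` IS
  the dual cone of the set of curve classes), `IsAbelianVariety.coe_dual_setOf_semipos_eq` (`NE̅(X)_b` IS the dual
  cone of `Nef(X)_b` — the bipolar theorem of file 59 read in Mathlib's language), and
  `IsAbelianVariety.dual_curveCoords_eq_dual_closure_span` (the dual of the curve classes is the dual of `NE̅(X)_b`);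
* §2 **`NE̅(X)` IS POLYHEDRAL IFF `Nef(X)` IS** (`IsAbelianVariety.fg_dual_curveCoords_iff_fg_dual_setOf_semipos`:
  the nef cone `Nef(X)_b` is finitely generated — a V-cone, `Submodule.FG` — iff the closed cone of curves
  `NE̅(X)_b` is; each direction is one application of Minkowski–Weyl to the H-description of the other cone),
  with the two H-cone formulations `IsAbelianVariety.dualFG_dual_setOf_semipos_of_fg` /
  `IsAbelianVariety.dualFG_dual_curveCoords_of_fg`.

This is the REAL-coefficient form of Bauer's remark; his statement is about RATIONAL polyhedral cones (finitely
many generators in `NS(X) ⊗ ℚ`, resp. in `N₁(X)_ℚ`), for which one needs Minkowski–Weyl over the `ℚ`-structure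
(Fourier–Motzkin preserves rationality).
-- TODO(general form): `NE̅(X)` rational polyhedral ⟺ `Nef(X)` rational polyhedral (Bauer §4), via a
-- `ℚ`-structure version of `fg_iff_dualFG_dotProduct`; joined to `IsAbelianVariety.nefCone_polyhedral_tfae` of
-- `ComplexTorusNefConePolyhedralCriterion` it would add Bauer's (i) "`NE̅(X)` is rational polyhedral" to that list.

## References

* [Bauer1998ConeOfCurves] Th. Bauer, *On the cone of curves of an abelian variety*, Amer. J. Math. 120 (1998)
  997–1006, §4 (the duality `Nef(X) = NE̅(X)^∨`, `NE̅(X) = Nef(X)^∨` and "(i) ⟺ (i)'") (held: arXiv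
  alg-geom/9712019, p. 5).
* [KollarMori1998] J. Kollár, S. Mori, *Birational Geometry of Algebraic Varieties*, Cambridge Tracts in
  Math. 134, CUP 1998, §1.3 Def. 1.17 and the remark before Thm. 1.18 (held copy, p. 19).
* [Schrijver1986] A. Schrijver, *Theory of Linear and Integer Programming*, Wiley 1986, §7.2 Cor. 7.1a (p. 87).
-/

noncomputable section

open scoped Manifold ComplexOrder NNReal InnerProductSpace
open Complex Set Function Module Filter Topology Matrix

namespace Literature.Geometry.Kaehler

namespace ComplexTorus

universe u

variable {ι : Type*} [Fintype ι] [DecidableEq ι] {E : Type u} [NormedAddCommGroup E] [InnerProductSpace ℂ E]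
  [FiniteDimensional ℂ E] [MeasurableSpace E] [BorelSpace E] (Φ : (ι → ℝ) ≃L[ℝ] E) {g n : ℕ}

/-! ### §1 The nef cone and the closed cone of curves as dual cones (H-descriptions) -/

/-- **`Nef(X) = NE(X)^∨` in Mathlib's language**: in the coordinates of a `ℤ`-basis `b` of `NS(X)`, the dual
cone (for the dot product) of the set of classes `[C]_b = (C · b_j)_j` of the irreducible curves is the nef cone
`{c | H_{Σ c_j b_j} ≥ 0}`. [cite: Bauer1998ConeOfCurves, §4 ("`Nef(X) = {λ ∈ NS_ℝ(X) | λξ ≥ 0 for all ξ ∈ NE(X)}`")]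
[cite: KollarMori1998, §1.3 Def. 1.17] -/
theorem IsAbelianVariety.coe_dual_curveCoords_eq (hX : IsAbelianVariety Φ) (e : Fin (2 * g) ≃ ι)
    (b : Basis (Fin n) ℤ (neronSeveriGroup Φ)) :
    (PointedCone.dual (dotProductBilin ℝ ℝ (m := Fin n) (A := ℝ))
        {w : Fin n → ℝ | ∃ (C : Set (ComplexTorus Φ)) (hC : HasPureDim 𝓘(ℂ, E) C 1),
          IsIrreducibleAnalyticSet 𝓘(ℂ, E) C ∧
            w = fun j ↦ (analyticCyclePeriod Φ hC (ofRealForm (-((b j : neronSeveriGroup Φ) : E [⋀^Fin 2]→L[ℝ] ℝ)))).re} :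
        Set (Fin n → ℝ)) =
      {c | ∀ v : E, 0 ≤ (∑ j, c j • ((b j : neronSeveriGroup Φ) : E [⋀^Fin 2]→L[ℝ] ℝ)) ![I • v, v]} := by
  ext c
  rw [SetLike.mem_coe, PointedCone.mem_dual, Set.mem_setOf_eq,
    hX.semipos_sum_smul_iff_forall_curve_sum_mul_nonneg Φ e b c]
  constructor
  · intro h C hC hirr
    have h' := h ⟨C, hC, hirr, rfl⟩
    rw [dotProductBilin_apply_apply, dotProduct_comm] at h'
    exact h'
  · rintro h w ⟨C, hC, hirr, rfl⟩
    rw [dotProductBilin_apply_apply, dotProduct_comm]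
    exact h C hC hirr

/-- **`NE̅(X) = Nef(X)^∨` in Mathlib's language**: the dual cone of the nef cone `{c | H_{Σ c_j b_j} ≥ 0}` is
the closed cone of curves — the closure of the `ℝ≥0`-span of the classes of the irreducible curves (the
bipolar theorem `IsAbelianVariety.closure_span_curveCoords_eq`). [cite: Bauer1998ConeOfCurves, §4 ("The dual of `Nef(X)` in turn is the closed cone `NE̅(X)`")]
[cite: KollarMori1998, §1.3 ("The closure of the cone of nef divisors is dual to the cone of effective 1-cycles")] -/
theorem IsAbelianVariety.coe_dual_setOf_semipos_eq (hX : IsAbelianVariety Φ) (e : Fin (2 * g) ≃ ι)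
    (b : Basis (Fin n) ℤ (neronSeveriGroup Φ)) :
    (PointedCone.dual (dotProductBilin ℝ ℝ (m := Fin n) (A := ℝ))
        {c : Fin n → ℝ | ∀ v : E, 0 ≤ (∑ j, c j • ((b j : neronSeveriGroup Φ) : E [⋀^Fin 2]→L[ℝ] ℝ)) ![I • v, v]} :
        Set (Fin n → ℝ)) =
      closure (Submodule.span ℝ≥0 {w : Fin n → ℝ | ∃ (C : Set (ComplexTorus Φ)) (hC : HasPureDim 𝓘(ℂ, E) C 1),
        IsIrreducibleAnalyticSet 𝓘(ℂ, E) C ∧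
          w = fun j ↦ (analyticCyclePeriod Φ hC (ofRealForm (-((b j : neronSeveriGroup Φ) : E [⋀^Fin 2]→L[ℝ] ℝ)))).re} :
            Set (Fin n → ℝ)) := by
  rw [hX.closure_span_curveCoords_eq Φ e b]
  ext w
  simp only [SetLike.mem_coe, PointedCone.mem_dual, Set.mem_setOf_eq, dotProductBilin_apply_apply, dotProduct]

/-- **The dual of the curve classes is the dual of the closed cone of curves** (a class which is `≥ 0` on
every irreducible curve is nef, hence `≥ 0` on `NE̅(X)`). [cite: Bauer1998ConeOfCurves, §4 ("`Nef(X)` is the dual of `NE̅(X)`, `Nef(X) = {λ | λξ ≥ 0 for all ξ ∈ NE(X)}`")]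
[cite: KollarMori1998, §1.3 Def. 1.17] -/
theorem IsAbelianVariety.dual_curveCoords_eq_dual_closure_span (hX : IsAbelianVariety Φ) (e : Fin (2 * g) ≃ ι)
    (b : Basis (Fin n) ℤ (neronSeveriGroup Φ)) :
    PointedCone.dual (dotProductBilin ℝ ℝ (m := Fin n) (A := ℝ))
        {w : Fin n → ℝ | ∃ (C : Set (ComplexTorus Φ)) (hC : HasPureDim 𝓘(ℂ, E) C 1),
          IsIrreducibleAnalyticSet 𝓘(ℂ, E) C ∧
            w = fun j ↦ (analyticCyclePeriod Φ hC (ofRealForm (-((b j : neronSeveriGroup Φ) : E [⋀^Fin 2]→L[ℝ] ℝ)))).re} =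
      PointedCone.dual (dotProductBilin ℝ ℝ (m := Fin n) (A := ℝ))
        (closure (Submodule.span ℝ≥0 {w : Fin n → ℝ | ∃ (C : Set (ComplexTorus Φ))
          (hC : HasPureDim 𝓘(ℂ, E) C 1), IsIrreducibleAnalyticSet 𝓘(ℂ, E) C ∧
            w = fun j ↦ (analyticCyclePeriod Φ hC (ofRealForm (-((b j : neronSeveriGroup Φ) : E [⋀^Fin 2]→L[ℝ] ℝ)))).re} :
              Set (Fin n → ℝ))) := by
  refine le_antisymm (fun c hc w hw ↦ ?_) (PointedCone.dual_anti (Submodule.subset_span.trans subset_closure))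
  have hc' : c ∈ (PointedCone.dual (dotProductBilin ℝ ℝ (m := Fin n) (A := ℝ))
      {w : Fin n → ℝ | ∃ (C : Set (ComplexTorus Φ)) (hC : HasPureDim 𝓘(ℂ, E) C 1),
        IsIrreducibleAnalyticSet 𝓘(ℂ, E) C ∧
          w = fun j ↦ (analyticCyclePeriod Φ hC (ofRealForm (-((b j : neronSeveriGroup Φ) : E [⋀^Fin 2]→L[ℝ] ℝ)))).re} :
      Set (Fin n → ℝ)) := hc
  rw [hX.coe_dual_curveCoords_eq Φ e b, Set.mem_setOf_eq] at hc'
  rw [dotProductBilin_apply_apply, dotProduct_comm]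
  exact sum_mul_nonneg_of_mem_closure_span_curveCoords Φ b hw hc'

omit [Fintype ι] [DecidableEq ι] [FiniteDimensional ℂ E] [MeasurableSpace E] [BorelSpace E] in
/-- The dual cone of the `ℝ≥0`-span of a set is the dual cone of the set (`PointedCone.dual_hull`). [folklore] -/
private theorem dual_coe_span_eq₆₀ (s : Set (Fin n → ℝ)) :
    PointedCone.dual (dotProductBilin ℝ ℝ (m := Fin n) (A := ℝ))
        ((Submodule.span {c : ℝ // 0 ≤ c} s : Submodule {c : ℝ // 0 ≤ c} (Fin n → ℝ)) : Set (Fin n → ℝ)) =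
      PointedCone.dual (dotProductBilin ℝ ℝ (m := Fin n) (A := ℝ)) s :=
  PointedCone.dual_hull s

/-! ### §2 `NE̅(X)` is polyhedral iff `Nef(X)` is polyhedral (Minkowski–Weyl) -/

/-- **If `Nef(X)` is finitely generated then `NE̅(X)` is an H-cone**: generators `t` of the nef cone cut out
`NE̅(X)_b = {z | λ · z ≥ 0 for all λ ∈ t}`. [cite: Bauer1998ConeOfCurves, §4 ("The dual of `Nef(X)` in turn is the closed cone `NE̅(X)`")] -/
theorem IsAbelianVariety.dualFG_dual_setOf_semipos_of_fg (hX : IsAbelianVariety Φ) (e : Fin (2 * g) ≃ ι)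
    (b : Basis (Fin n) ℤ (neronSeveriGroup Φ))
    (hfg : (PointedCone.dual (dotProductBilin ℝ ℝ (m := Fin n) (A := ℝ))
      {w : Fin n → ℝ | ∃ (C : Set (ComplexTorus Φ)) (hC : HasPureDim 𝓘(ℂ, E) C 1),
        IsIrreducibleAnalyticSet 𝓘(ℂ, E) C ∧
          w = fun j ↦ (analyticCyclePeriod Φ hC (ofRealForm (-((b j : neronSeveriGroup Φ) : E [⋀^Fin 2]→L[ℝ] ℝ)))).re}).FG) :
    (PointedCone.dual (dotProductBilin ℝ ℝ (m := Fin n) (A := ℝ))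
        {c : Fin n → ℝ | ∀ v : E, 0 ≤ (∑ j, c j • ((b j : neronSeveriGroup Φ) : E [⋀^Fin 2]→L[ℝ] ℝ)) ![I • v, v]}).DualFG
      (dotProductBilin ℝ ℝ (m := Fin n) (A := ℝ)) := by
  obtain ⟨t, ht⟩ := hfg
  refine ⟨t, ?_⟩
  rw [← hX.coe_dual_curveCoords_eq Φ e b, ← ht, dual_coe_span_eq₆₀]

/-- **If `NE̅(X)` is finitely generated then `Nef(X)` is an H-cone**: generators `t` of the closed cone of
curves cut out `Nef(X)_b = {λ | λ · z ≥ 0 for all z ∈ t}`. [cite: Bauer1998ConeOfCurves, §4 ("the nef cone `Nef(X) ⊂ NS_ℝ(X)` is the dual of `NE̅(X)`")] -/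
theorem IsAbelianVariety.dualFG_dual_curveCoords_of_fg (hX : IsAbelianVariety Φ) (e : Fin (2 * g) ≃ ι)
    (b : Basis (Fin n) ℤ (neronSeveriGroup Φ))
    (hfg : (PointedCone.dual (dotProductBilin ℝ ℝ (m := Fin n) (A := ℝ))
      {c : Fin n → ℝ | ∀ v : E, 0 ≤ (∑ j, c j • ((b j : neronSeveriGroup Φ) : E [⋀^Fin 2]→L[ℝ] ℝ)) ![I • v, v]}).FG) :
    (PointedCone.dual (dotProductBilin ℝ ℝ (m := Fin n) (A := ℝ))
        {w : Fin n → ℝ | ∃ (C : Set (ComplexTorus Φ)) (hC : HasPureDim 𝓘(ℂ, E) C 1),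
          IsIrreducibleAnalyticSet 𝓘(ℂ, E) C ∧
            w = fun j ↦ (analyticCyclePeriod Φ hC (ofRealForm (-((b j : neronSeveriGroup Φ) : E [⋀^Fin 2]→L[ℝ] ℝ)))).re}).DualFG
      (dotProductBilin ℝ ℝ (m := Fin n) (A := ℝ)) := by
  obtain ⟨t, ht⟩ := hfg
  refine ⟨t, ?_⟩
  rw [hX.dual_curveCoords_eq_dual_closure_span Φ e b, ← hX.coe_dual_setOf_semipos_eq Φ e b, ← ht,
    dual_coe_span_eq₆₀]

/-- **`NE̅(X)` is polyhedral iff `Nef(X)` is polyhedral** (real coefficients): in the coordinates of a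
`ℤ`-basis of `NS(X)` of a complex abelian variety, the nef cone `Nef(X)_b = {c | H_{Σ c_j b_j} ≥ 0}` is finitely
generated (the `ℝ≥0`-span of finitely many vectors) iff the closed cone of curves `NE̅(X)_b` is — "the nef cone
is the dual of `NE̅(X)` […] The dual of `Nef(X)` in turn is the closed cone `NE̅(X)`. So the statement that
`NE̅(X)` is […] polyhedral is equivalent to (i)' The nef cone `Nef(X)` is […] polyhedral", each direction being
the Farkas–Minkowski–Weyl theorem ("a convex cone is polyhedral if and only if it is finitely generated")
applied to the H-description of the other cone. [cite: Bauer1998ConeOfCurves, §4 ((i) ⟺ (i)')]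
[cite: Schrijver1986, §7.2 Cor. 7.1a (p. 87)] [cite: KollarMori1998, §1.3 (before Thm. 1.18)] -/
theorem IsAbelianVariety.fg_dual_curveCoords_iff_fg_dual_setOf_semipos (hX : IsAbelianVariety Φ)
    (e : Fin (2 * g) ≃ ι) (b : Basis (Fin n) ℤ (neronSeveriGroup Φ)) :
    (PointedCone.dual (dotProductBilin ℝ ℝ (m := Fin n) (A := ℝ))
        {w : Fin n → ℝ | ∃ (C : Set (ComplexTorus Φ)) (hC : HasPureDim 𝓘(ℂ, E) C 1),
          IsIrreducibleAnalyticSet 𝓘(ℂ, E) C ∧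
            w = fun j ↦ (analyticCyclePeriod Φ hC (ofRealForm (-((b j : neronSeveriGroup Φ) : E [⋀^Fin 2]→L[ℝ] ℝ)))).re}).FG ↔
      (PointedCone.dual (dotProductBilin ℝ ℝ (m := Fin n) (A := ℝ))
        {c : Fin n → ℝ | ∀ v : E, 0 ≤ (∑ j, c j • ((b j : neronSeveriGroup Φ) : E [⋀^Fin 2]→L[ℝ] ℝ)) ![I • v, v]}).FG := by
  constructor
  · intro hfg
    rw [Literature.Analysis.Convex.FarkasMinkowskiWeyl.fg_iff_dualFG_dotProduct]
    exact hX.dualFG_dual_setOf_semipos_of_fg Φ e b hfg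
  · intro hfg
    rw [Literature.Analysis.Convex.FarkasMinkowskiWeyl.fg_iff_dualFG_dotProduct]
    exact hX.dualFG_dual_curveCoords_of_fg Φ e b hfg

end ComplexTorus

end Literature.Geometry.Kaehler

end
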